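import Literature.AnabelianGeometry.EtaleTheta.FrobenioidRootTransport

/-!
# [EtTh] §5, Theorem 5.7 / Theorem 4.4 (iv) at the `N`-th root: category-theoreticity on isomorphism classes of `Ψ`, and the identity iso-component (pp. 329–331, 334 / PDF pp. 103–105, 108)

Mochizuki, *The étale theta function and its Frobenioid-theoretic manifestations*, Publ. RIMS **45**
(2009), Theorem 5.7 p.329–330 (PDF pp.103–104), Theorem 4.4 (iv) p.320 (PDF p.94), Theorem 5.10 (ii)
p.334 (PDF p.108) [cite: MochizukiEtTh2009, Thm 5.7 p.329–330 (PDF pp.103–104)].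
Cell abc-iut, block F (fact-proving wave), seat abc-iut-f-124 (tranche 124: FACT-LIST rows F-0548
`ThetaFrobenioid.RootTransport`, F-0549 `ThetaFrobenioid.RootTransportWith`, F-0550
`ThetaFrobenioid.ThetaRootPreserved`, F-2768 `ThetaFrobenioid.StrvTransport`).  PROOF-ONLY companion of
abc-iut-L2-t4's statement file `FrobenioidRootTransport.lean`; no definition, no new `Prop` fact, no edit of
the statement file.  It COMPLEMENTS abc-iut-w5-d066's `Discharge/Sec5Thm57UniversalClosureRefuted.lean`
(p431469: the universal closures of all four rows over the DATA-ONLY §5 interface are FALSE) with the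
POSITIVE instance forms that hold for EVERY §5 datum `𝔉 : ThetaFrobenioid C D`:

(a) **Category-theoreticity on isomorphism classes.**  Theorem 5.7 is a statement about a self-equivalence
`Ψ : C ⥲ C` considered, as always in [FrdI]/[EtTh], up to isomorphism.  The four typed predicates depend on
`Ψ` only through the natural-isomorphism class of `Ψ.functor`: for `η : Ψ.functor ≅ Ψ'.functor` the
identifications `α' : Ψ'(A_N) ⥲ A_N`, `β' : Ψ'(B_N) ⥲ B_N` re-base along `η` to `η_{A_N} ≫ α'`, `η_{B_N} ≫ β'`
with the SAME transported arrows (`transport_natIso`, from the naturality square of `η`), hence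
`rootTransportWith_iff_of_natIso`, `rootTransport_iff_of_natIso`, `thetaRootPreserved_iff_of_natIso`,
`strvTransport_iff_of_natIso` — same witnesses `e, D_c, D_p`, same base transport `θ`.
(b) **The identity iso-component.**  For every `Ψ` with `η : Ψ.functor ≅ 𝟭 C` and EVERY `α, β`:
`RootTransportWith Ψ α β e D_c D_p` with `e = α⁻¹ ≫ η_{A_N}`, `D_c = D_p = η_{B_N}⁻¹ ≫ β`, so that the
discrepancy `D_c⁻¹ · D_p = 1` (`δ₂ = δ₃ = 1`: no root of unity, no `l·ℤ`-translate) —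
`rootTransportWith_of_iso_refl`; hence `ThetaRootPreserved Ψ` (`thetaRootPreserved_of_iso_refl`); and
Theorem 4.4 (iv)'s transport of `s^trv_N` with the SAME `e` and `θ = id` (`strvTransport_of_iso_refl`), i.e.
exactly the pair of binders `(hroot, hstrv)` of abc-iut-L2-d4's `Sec5Thm510ii.psiAutPreserves_of`, packaged
as `rootTransportWith_and_strvTransport_of_iso_refl` (the witness-exposed forms take `η` spelled
`Ψ.functor ≅ (Equivalence.refl).functor`, which is `𝟭 C` by definition — any `η : Ψ.functor ≅ 𝟭 C` may be passed;
the headline corollaries `thetaRootPreserved_of_iso_id`, `rootTransport_of_iso_id`,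
`exists_rootTransportWith_and_strvTransport_of_iso_id` are spelled with `𝟭 C`).  The case `Ψ = 𝟭` itself:
`rootTransportWith_refl`, `rootTransport_refl`, `thetaRootPreserved_refl`, `strvTransport_refl`.  The
exact-name check of the thirteen theorems against the typed rows is the `example` block at the end.

WHAT THIS MEANS FOR THE ROWS (R5, with p431469).  The rows are admissible AT NAMED INSTANCES ONLY; as
instances they are: PROVED on the isomorphism class of `𝟭_C` for all data (this file); conditional at the
model / the genuine towers (abc-iut-L2-d4: `Sec5Thm57.rootTransport_of`, `thetaRootPreserved_of`,
`Sec5ModelCase.rootTransport_of_model`, `…OfConnectedTemperoidYddFamily.thetaRootPreservedAll_…`, residual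
`hc` = Cor. 2.8 (i) on the Kummer classes); `∃`-unit form for `s^trv_N` at `ofBiKummerData` (abc-iut-w5-d245,
`exists_unit_strvTransport_ofBiKummerData`).  The CONTENT of Theorem 5.7 — "rigidity … up to possible
multiplication by a `2l`-th root of unity", proof p.330 (PDF p.104) via Cor. 2.8 (i), Rmk. 4.3.2, Prop. 5.2
(iii), Prop. 5.5, Thm. 5.6 — lies entirely in the NON-identity isomorphism classes of self-equivalences; this
file says nothing about them.  HONEST FRAMING: kernel-checked tautologies of the typed predicates; nothing of
[EtTh] is asserted for the tempered Frobenioid of §5; no side is taken on [IUTchIII] Cor. 3.12; typed ≠ proved.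
-/

namespace Literature.AnabelianGeometry.EtaleTheta

open CategoryTheory

universe w v v' u u'

namespace ThetaFrobenioid

variable {C : Type u} [Category.{v} C] {D : Type u'} [Category.{v'} D] (𝔉 : ThetaFrobenioid.{w} C D)

/-! ### (a) Category-theoreticity on isomorphism classes of the self-equivalence -/

section NatIso

variable {Ψ Ψ' : C ≌ C}

omit 𝔉 in
/-- Re-basing the identifications along a natural isomorphism `η : Ψ ≅ Ψ'` does not change the transported
arrow: `(η_X ≫ α')⁻¹ ≫ Ψ(f) ≫ (η_Y ≫ β') = α'⁻¹ ≫ Ψ'(f) ≫ β'` (the naturality square of `η` at `f`; [FrdI]/[EtTh]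
consider self-equivalences up to isomorphism, cf. Rmk. 5.1.1 p.323 (PDF p.97)).
[cite: MochizukiEtTh2009, Thm 5.10 (ii) p.334 (PDF p.108)] -/
theorem transport_natIso (η : Ψ.functor ≅ Ψ'.functor) {X Y X' Y' : C} (f : X ⟶ Y)
    (α' : Ψ'.functor.obj X ≅ X')
    (β' : Ψ'.functor.obj Y ≅ Y') :
    (η.app X ≪≫ α').inv ≫ Ψ.functor.map f ≫ (η.app Y ≪≫ β').hom =
      α'.inv ≫ Ψ'.functor.map f ≫ β'.hom := by
  rw [← NatIso.naturality_1 η f]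
  simp only [Iso.trans_inv, Iso.trans_hom, Iso.app_inv, Iso.app_hom, Category.assoc]

/-- **Theorem 5.7 at the `N`-th root, witnesses exposed, is invariant under `Ψ ↦ Ψ'` along `η : Ψ ≅ Ψ'`**
(identifications re-based along `η`, SAME witnesses `e, D_c, D_p`).
[cite: MochizukiEtTh2009, Thm 5.7 p.329–330 (PDF pp.103–104)] -/
theorem rootTransportWith_iff_of_natIso (η : Ψ.functor ≅ Ψ'.functor)
    (α' : Ψ'.functor.obj 𝔉.AN ≅ 𝔉.AN) (β' : Ψ'.functor.obj 𝔉.BN ≅ 𝔉.BN) (e : 𝔉.AN ≅ 𝔉.AN)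
    (Dc Dp : Aut 𝔉.BN) :
    𝔉.RootTransportWith Ψ (η.app 𝔉.AN ≪≫ α') (η.app 𝔉.BN ≪≫ β') e Dc Dp ↔
      𝔉.RootTransportWith Ψ' α' β' e Dc Dp := by
  simp only [RootTransportWith, transport_natIso η]

/-- **Theorem 5.7 at the `N`-th root (`RootTransport`) is invariant under `Ψ ↦ Ψ'` along `η : Ψ ≅ Ψ'`.**
[cite: MochizukiEtTh2009, Thm 5.7 p.329–330 (PDF pp.103–104)] -/
theorem rootTransport_iff_of_natIso (η : Ψ.functor ≅ Ψ'.functor)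
    (α' : Ψ'.functor.obj 𝔉.AN ≅ 𝔉.AN) (β' : Ψ'.functor.obj 𝔉.BN ≅ 𝔉.BN) :
    𝔉.RootTransport Ψ (η.app 𝔉.AN ≪≫ α') (η.app 𝔉.BN ≪≫ β') ↔ 𝔉.RootTransport Ψ' α' β' := by
  rw [rootTransport_iff, rootTransport_iff]
  simp only [rootTransportWith_iff_of_natIso 𝔉 η]

/-- `ThetaRootPreserved` passes from `Ψ` to any naturally isomorphic `Ψ'`.
[cite: MochizukiEtTh2009, Thm 5.7 p.329–330 (PDF pp.103–104)] -/
theorem thetaRootPreserved_of_natIso (η : Ψ.functor ≅ Ψ'.functor) (h : 𝔉.ThetaRootPreserved Ψ) :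
    𝔉.ThetaRootPreserved Ψ' :=
  fun α' β' => (rootTransport_iff_of_natIso 𝔉 η α' β').mp (h _ _)

/-- **Theorem 5.7, root-level form for all choices (`ThetaRootPreserved`), depends on `Ψ` only through its
natural-isomorphism class** — the sense in which a "category-theoretic" property of a self-equivalence is
read ([EtTh] Rmk. 5.1.1 p.323 (PDF p.97); [FrdI] §0).  [cite: MochizukiEtTh2009, Thm 5.7 p.329–330 (PDF pp.103–104)] -/
theorem thetaRootPreserved_iff_of_natIso (η : Ψ.functor ≅ Ψ'.functor) :
    𝔉.ThetaRootPreserved Ψ ↔ 𝔉.ThetaRootPreserved Ψ' :=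
  ⟨thetaRootPreserved_of_natIso 𝔉 η, thetaRootPreserved_of_natIso 𝔉 η.symm⟩

/-- **Theorem 4.4 (iv) at the `N`-th root (`StrvTransport`, the transport of `s^trv_N`) is invariant under
`Ψ ↦ Ψ'` along `η : Ψ ≅ Ψ'`** (identification re-based along `η`, SAME `e` and SAME base transport `θ`).
[cite: MochizukiEtTh2009, Thm 4.4 (iv) p.320 (PDF p.94); Thm 5.10 (ii) p.334 (PDF p.108)] -/
theorem strvTransport_iff_of_natIso (η : Ψ.functor ≅ Ψ'.functor) (α' : Ψ'.functor.obj 𝔉.AN ≅ 𝔉.AN)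
    (e : 𝔉.AN ≅ 𝔉.AN) (θ : Aut (𝔉.base.obj 𝔉.BN) ≃* Aut (𝔉.base.obj 𝔉.BN)) :
    𝔉.StrvTransport Ψ (η.app 𝔉.AN ≪≫ α') e θ ↔ 𝔉.StrvTransport Ψ' α' e θ := by
  refine forall_congr' fun g => ?_
  rw [← NatIso.naturality_1 η (𝔉.strv (𝔉.autBaseIsoAB.symm g)).hom]
  simp only [Iso.trans_inv, Iso.trans_hom, Iso.app_inv, Iso.app_hom, Category.assoc]

end NatIso

/-! ### The identity self-equivalence `Ψ = 𝟭_C` -/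

section Refl

/-- **Theorem 5.7 at the `N`-th root for `Ψ = 𝟭_C`, witnesses exposed**: for any `α ∈ Aut(A_N)`, `β ∈ Aut(B_N)`
read as identifications `𝟭(A_N) ⥲ A_N`, `𝟭(B_N) ⥲ B_N`: `RootTransportWith 𝟭 α β α⁻¹ β β` — the transported
pair IS `(α⁻¹ ≫ s^⊓_N ≫ β, α⁻¹ ≫ s^⊔_N ≫ β)`, so `e = α⁻¹`, `D_c = D_p = β`, `D_c⁻¹ · D_p = 1 = δ₂ · δ₃` with
`δ₂ = δ₃ = 1`.  [cite: MochizukiEtTh2009, Thm 5.7 p.329–330 (PDF pp.103–104)] -/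
theorem rootTransportWith_refl (α : 𝔉.AN ≅ 𝔉.AN) (β : 𝔉.BN ≅ 𝔉.BN) :
    𝔉.RootTransportWith (CategoryTheory.Equivalence.refl : C ≌ C) α β α.symm β β :=
  ⟨rfl, rfl, 1, one_mem _, 1, one_mem _, by rw [inv_mul_cancel, mul_one]⟩

/-- `RootTransport 𝟭_C α β` for EVERY §5 datum and every `α, β`.
[cite: MochizukiEtTh2009, Thm 5.7 p.329–330 (PDF pp.103–104)] -/
theorem rootTransport_refl (α : 𝔉.AN ≅ 𝔉.AN) (β : 𝔉.BN ≅ 𝔉.BN) :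
    𝔉.RootTransport (CategoryTheory.Equivalence.refl : C ≌ C) α β :=
  RootTransportWith.rootTransport 𝔉 (rootTransportWith_refl 𝔉 α β)

/-- **`ThetaRootPreserved 𝟭_C` for EVERY §5 datum** (Theorem 5.7, root-level form for all choices, at the
identity).  [cite: MochizukiEtTh2009, Thm 5.7 p.329–330 (PDF pp.103–104)] -/
theorem thetaRootPreserved_refl : 𝔉.ThetaRootPreserved (CategoryTheory.Equivalence.refl : C ≌ C) :=
  fun α β => rootTransport_refl 𝔉 α β

/-- **`StrvTransport 𝟭_C α α⁻¹ id` for EVERY §5 datum** (Theorem 4.4 (iv) at the `N`-th root for the identity: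
conjugating `s^trv_N(g)` by `α` and back by `e = α⁻¹` returns `s^trv_N(g)`; base transport `θ = id`).
[cite: MochizukiEtTh2009, Thm 4.4 (iv) p.320 (PDF p.94)] -/
theorem strvTransport_refl (α : 𝔉.AN ≅ 𝔉.AN) :
    𝔉.StrvTransport (CategoryTheory.Equivalence.refl : C ≌ C) α α.symm (MulEquiv.refl _) := by
  intro g
  show α.inv ≫ (𝔉.strv (𝔉.autBaseIsoAB.symm g)).hom ≫ α.hom ≫ α.inv =
    α.inv ≫ (𝔉.strv (𝔉.autBaseIsoAB.symm g)).hom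
  rw [Iso.hom_inv_id, Category.comp_id]

end Refl

/-! ### (b) The identity iso-component `Ψ ≅ 𝟭_C`: (a) applied to the identity case -/

section IsoRefl

/-! Throughout, `η : Ψ.functor ≅ (Equivalence.refl).functor` — by definition `(Equivalence.refl).functor = 𝟭 C`, so any
`η : Ψ.functor ≅ 𝟭 C` may be passed verbatim; the `refl` spelling keeps the identifications syntactically
uniform with part (a).  The `𝟭 C`-spelled headline corollaries follow the section. -/

variable {Ψ : C ≌ C}

/-- **Theorem 5.7 at the `N`-th root, witnesses exposed, on the identity iso-component.**  For `η : Ψ ≅ 𝟭_C`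
and ANY identifications `α : Ψ(A_N) ⥲ A_N`, `β : Ψ(B_N) ⥲ B_N`: the transported pair
`(α⁻¹ ≫ Ψ(s^⊓_N) ≫ β, α⁻¹ ≫ Ψ(s^⊔_N) ≫ β)` equals `(e ≫ s^⊓_N ≫ D_c, e ≫ s^⊔_N ≫ D_p)` with `e := α⁻¹ ≫ η_{A_N}`,
`D_c = D_p := η_{B_N}⁻¹ ≫ β`, and the discrepancy `D_c⁻¹ · D_p = 1 = δ₂ · δ₃` with `δ₂ = 1 ∈ μ_{2l·N}(B_N) ∩ (O_K^×)^{1/N}`,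
`δ₃ = 1 ∈ Im(s^⊓-gp_N)` — no root of unity and no translate are needed on this component.  (= `rootTransportWith_refl`
re-based along `η` by `rootTransportWith_iff_of_natIso`.)
[cite: MochizukiEtTh2009, Thm 5.7 p.329–330 (PDF pp.103–104); Prop 4.2 (iv) p.315 (PDF p.89)] -/
theorem rootTransportWith_of_iso_refl (η : Ψ.functor ≅ (CategoryTheory.Equivalence.refl : C ≌ C).functor)
    (α : Ψ.functor.obj 𝔉.AN ≅ 𝔉.AN) (β : Ψ.functor.obj 𝔉.BN ≅ 𝔉.BN) :
    𝔉.RootTransportWith Ψ α β (α.symm ≪≫ η.app 𝔉.AN) ((η.app 𝔉.BN).symm ≪≫ β)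
      ((η.app 𝔉.BN).symm ≪≫ β) := by
  -- `rootTransportWith_refl` at `α' := η_{A_N}⁻¹ ≫ α`, `β' := η_{B_N}⁻¹ ≫ β` (its witness `α'⁻¹` is `α⁻¹ ≫ η_{A_N}`
  -- definitionally), re-based along `η` by part (a).
  have h := (rootTransportWith_iff_of_natIso 𝔉 (Ψ' := CategoryTheory.Equivalence.refl) η
    ((η.app 𝔉.AN).symm ≪≫ α) ((η.app 𝔉.BN).symm ≪≫ β) (α.symm ≪≫ η.app 𝔉.AN) _ _).mpr
    (rootTransportWith_refl 𝔉 ((η.app 𝔉.AN).symm ≪≫ α) ((η.app 𝔉.BN).symm ≪≫ β))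
  simpa only [Iso.self_symm_id_assoc] using h

/-- **Theorem 5.7 at the `N`-th root (`RootTransport Ψ α β`) on the identity iso-component**, for every `α, β`.
[cite: MochizukiEtTh2009, Thm 5.7 p.329–330 (PDF pp.103–104)] -/
theorem rootTransport_of_iso_refl (η : Ψ.functor ≅ (CategoryTheory.Equivalence.refl : C ≌ C).functor)
    (α : Ψ.functor.obj 𝔉.AN ≅ 𝔉.AN) (β : Ψ.functor.obj 𝔉.BN ≅ 𝔉.BN) : 𝔉.RootTransport Ψ α β :=
  RootTransportWith.rootTransport 𝔉 (rootTransportWith_of_iso_refl 𝔉 η α β)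

/-- **Theorem 5.7, root-level form for all choices (`ThetaRootPreserved Ψ`), holds for EVERY §5 datum on the
identity iso-component `Ψ ≅ 𝟭_C`.**  The content of Theorem 5.7 ("rigidity … up to possible multiplication
by a `2l`-th root of unity", via Cor. 2.8 (i)) concerns the other isomorphism classes of self-equivalences.
[cite: MochizukiEtTh2009, Thm 5.7 p.329–330 (PDF pp.103–104)] -/
theorem thetaRootPreserved_of_iso_refl
    (η : Ψ.functor ≅ (CategoryTheory.Equivalence.refl : C ≌ C).functor) : 𝔉.ThetaRootPreserved Ψ :=
  (thetaRootPreserved_iff_of_natIso 𝔉 (Ψ' := CategoryTheory.Equivalence.refl) η).mpr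
    (thetaRootPreserved_refl 𝔉)

/-- **Theorem 4.4 (iv) at the `N`-th root (`StrvTransport`) on the identity iso-component**: for `η : Ψ ≅ 𝟭_C`
and any `α`, conjugating `Ψ(s^trv_N(g))` back along `α` and `e := α⁻¹ ≫ η_{A_N}` gives `s^trv_N(g)` — the
transport holds with base transport `θ = id` and the SAME `e` as `rootTransportWith_of_iso_refl`.
[cite: MochizukiEtTh2009, Thm 4.4 (iv) p.320 (PDF p.94); Thm 5.10 (ii) p.334 (PDF p.108)] -/
theorem strvTransport_of_iso_refl (η : Ψ.functor ≅ (CategoryTheory.Equivalence.refl : C ≌ C).functor)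
    (α : Ψ.functor.obj 𝔉.AN ≅ 𝔉.AN) :
    𝔉.StrvTransport Ψ α (α.symm ≪≫ η.app 𝔉.AN) (MulEquiv.refl _) := by
  have h := (strvTransport_iff_of_natIso 𝔉 (Ψ' := CategoryTheory.Equivalence.refl) η
    ((η.app 𝔉.AN).symm ≪≫ α) (α.symm ≪≫ η.app 𝔉.AN) (MulEquiv.refl _)).mpr
    (strvTransport_refl 𝔉 ((η.app 𝔉.AN).symm ≪≫ α))
  simpa only [Iso.self_symm_id_assoc] using h

/-- **The SAME-`e` package on the identity iso-component** — exactly the two transport binders of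
abc-iut-L2-d4's `Sec5Thm510ii.psiAutPreserves_of` (`hroot : RootTransportWith Ψ α β e D_c D_p` = Thm. 5.7 and
`hstrv : StrvTransport Ψ α e θ` = Thm. 4.4 (iv); "print uses ONE identification `Ψ(A_N) ⥲ A_N` for Theorem 5.7
and Theorem 4.4 (iv) alike", proof of Thm. 5.10 (ii) pp.334–335 (PDF pp.108–109)), discharged for `Ψ ≅ 𝟭_C` with
`e = α⁻¹ ≫ η_{A_N}`, `D_c = D_p = η_{B_N}⁻¹ ≫ β` (so `D_c⁻¹ · D_p = 1`), `θ = id`.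
[cite: MochizukiEtTh2009, Thm 5.10 (ii) p.334–335 (PDF pp.108–109)] -/
theorem rootTransportWith_and_strvTransport_of_iso_refl
    (η : Ψ.functor ≅ (CategoryTheory.Equivalence.refl : C ≌ C).functor)
    (α : Ψ.functor.obj 𝔉.AN ≅ 𝔉.AN) (β : Ψ.functor.obj 𝔉.BN ≅ 𝔉.BN) :
    𝔉.RootTransportWith Ψ α β (α.symm ≪≫ η.app 𝔉.AN) ((η.app 𝔉.BN).symm ≪≫ β)
        ((η.app 𝔉.BN).symm ≪≫ β) ∧
      𝔉.StrvTransport Ψ α (α.symm ≪≫ η.app 𝔉.AN) (MulEquiv.refl _) :=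
  ⟨rootTransportWith_of_iso_refl 𝔉 η α β, strvTransport_of_iso_refl 𝔉 η α⟩

end IsoRefl

/-! ### Headline corollaries spelled with `𝟭 C` -/

section IsoId

variable {Ψ : C ≌ C}

/-- **`ThetaRootPreserved Ψ` for every §5 datum and every self-equivalence `Ψ` with `Ψ.functor ≅ 𝟭 C`**
(Theorem 5.7, root-level form for all choices, on the identity iso-component).
[cite: MochizukiEtTh2009, Thm 5.7 p.329–330 (PDF pp.103–104)] -/
theorem thetaRootPreserved_of_iso_id (η : Ψ.functor ≅ 𝟭 C) : 𝔉.ThetaRootPreserved Ψ :=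
  thetaRootPreserved_of_iso_refl 𝔉 η

/-- **`RootTransport Ψ α β` for every §5 datum, every `Ψ` with `Ψ.functor ≅ 𝟭 C`, and every `α, β`.**
[cite: MochizukiEtTh2009, Thm 5.7 p.329–330 (PDF pp.103–104)] -/
theorem rootTransport_of_iso_id (η : Ψ.functor ≅ 𝟭 C) (α : Ψ.functor.obj 𝔉.AN ≅ 𝔉.AN)
    (β : Ψ.functor.obj 𝔉.BN ≅ 𝔉.BN) : 𝔉.RootTransport Ψ α β :=
  rootTransport_of_iso_refl 𝔉 η α β

/-- **The binders `(hroot, hstrv)` of `Sec5Thm510ii.psiAutPreserves_of` are jointly satisfiable — with ONE `e`, equal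
codomain witnesses `D_c = D_p` and `θ = id` — for every §5 datum, every `Ψ` with `Ψ.functor ≅ 𝟭 C` and every `α, β`.**
[cite: MochizukiEtTh2009, Thm 5.10 (ii) p.334–335 (PDF pp.108–109)] -/
theorem exists_rootTransportWith_and_strvTransport_of_iso_id (η : Ψ.functor ≅ 𝟭 C)
    (α : Ψ.functor.obj 𝔉.AN ≅ 𝔉.AN) (β : Ψ.functor.obj 𝔉.BN ≅ 𝔉.BN) :
    ∃ (e : 𝔉.AN ≅ 𝔉.AN) (Dm : Aut 𝔉.BN), 𝔉.RootTransportWith Ψ α β e Dm Dm ∧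
      𝔉.StrvTransport Ψ α e (MulEquiv.refl _) :=
  ⟨_, _, rootTransportWith_and_strvTransport_of_iso_refl 𝔉 η α β⟩

end IsoId

/-! ### FQ-type checks (the row declarations, by fully-qualified name) -/

example {Ψ : C ≌ C} (η : Ψ.functor ≅ 𝟭 C) :
    Literature.AnabelianGeometry.EtaleTheta.ThetaFrobenioid.ThetaRootPreserved 𝔉 Ψ :=
  thetaRootPreserved_of_iso_id 𝔉 η

example {Ψ : C ≌ C} (η : Ψ.functor ≅ 𝟭 C) (α : Ψ.functor.obj 𝔉.AN ≅ 𝔉.AN) (β : Ψ.functor.obj 𝔉.BN ≅ 𝔉.BN) :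
    Literature.AnabelianGeometry.EtaleTheta.ThetaFrobenioid.RootTransport 𝔉 Ψ α β :=
  rootTransport_of_iso_id 𝔉 η α β

example {Ψ : C ≌ C} (η : Ψ.functor ≅ 𝟭 C) (α : Ψ.functor.obj 𝔉.AN ≅ 𝔉.AN) (β : Ψ.functor.obj 𝔉.BN ≅ 𝔉.BN) :
    ∃ (e : 𝔉.AN ≅ 𝔉.AN) (Dm : Aut 𝔉.BN),
      Literature.AnabelianGeometry.EtaleTheta.ThetaFrobenioid.RootTransportWith 𝔉 Ψ α β e Dm Dm ∧
      Literature.AnabelianGeometry.EtaleTheta.ThetaFrobenioid.StrvTransport 𝔉 Ψ α e (MulEquiv.refl _) :=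
  exists_rootTransportWith_and_strvTransport_of_iso_id 𝔉 η α β

example {Ψ Ψ' : C ≌ C} (η : Ψ.functor ≅ Ψ'.functor) :
    Literature.AnabelianGeometry.EtaleTheta.ThetaFrobenioid.ThetaRootPreserved 𝔉 Ψ ↔
      Literature.AnabelianGeometry.EtaleTheta.ThetaFrobenioid.ThetaRootPreserved 𝔉 Ψ' :=
  thetaRootPreserved_iff_of_natIso 𝔉 η

end ThetaFrobenioid

end Literature.AnabelianGeometry.EtaleTheta
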